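import Summits.CriticalPhenomena.PercolationContinuityZ3.Theorems.PercNearOneGluingNoHeavyLowerTailSunflowerSafePartition
import HarnessLib

/-!
# `NoHeavyLowerTail` (crux stmt-CriticalPhenomena-4575), abstract sunflower cubic: SAFETY FROM A FRACTIONAL (BALANCED-WEIGHT)
# CERTIFICATE — the cost-game form of the partition test

Support file (seat `prim-ineq-prove-1` gen 43; `--supports stmt-CriticalPhenomena-4575`).  No `sorry`, no named facts.
Memo: run/shared/lean/prim/prim-ineq-prove-1/FINDING-COSTGAME-prove1-g43.md §1–§2.

SETTING (as `…SunflowerSafePartition`).  `μ = prodBernoulli p`, an up-set `A` determined by a block `a`, a family `𝒯` of bad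
subsets of the block covering every bad missing set, `famIn p a 𝒯 𝒰 = μ(ω meets every C ∈ 𝒯 ∖ 𝒰)` the hitting function,
`famIn p a 𝒯 ∅ = μ A`.  By `safe_of_disjoint_famIn` safety of `A` follows from the PARTITION TEST
`∏_k famIn (𝒰 k) ≤ (famIn ∅)^(n−1)` for pairwise disjoint sub-families `𝒰 k ⊆ 𝒯`.

THE COST GAME.  With `g(ℛ) := −log μ(ω meets every C ∈ ℛ)` (`ℛ ⊆ 𝒯`; `g` is monotone, `g ∅ = 0`, subadditive by Harris)
the partition test reads `Σ_k g(𝒯 ∖ 𝒰 k) ≥ (n−1)·g(𝒯)` — a Shearer-type inequality for the covers "complements of a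
partition".  A p-independent-in-form SUFFICIENT condition is that the cost game `(𝒯, g)` has a NON-EMPTY CORE: weights
`ℓ ≥ 0` on `𝒯` with `Σ_{C ∈ ℛ} ℓ_C ≤ g(ℛ)` for all `ℛ` and `Σ_{C ∈ 𝒯} ℓ_C = g(𝒯)` (Bondareva–Shapley: iff `g(𝒯) ≤ Σ λ_ℛ g(ℛ)`
for every balanced collection).  In multiplicative form (`t_C = exp(−ℓ_C)`) this is the hypothesis of the theorem below.
* **`disjoint_famIn_of_weights`**: if `t : 𝒯 → [0,1]` satisfies `famIn 𝒰 ≤ ∏_{C ∈ 𝒯 ∖ 𝒰} t C` for every `𝒰 ⊆ 𝒯` and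
  `∏_{C ∈ 𝒯} t C ≤ famIn ∅`, then the partition test holds for EVERY number of classes (each `C` lies outside at least `n−1`
  of `n` pairwise disjoint classes, and `t C ≤ 1`);
* **`safe_of_weights`**: hence `A` is safe.
STATUS OF THE HYPOTHESIS (memo §2, numerics by an exact LP): log-supermodularity of the hitting function (class LSM, g35) ⟹
core non-empty ⟹ safe, both strictly.  For GRAPH cores the core is non-empty for every bipartite graph tested at every `p`
(conjecture BAL-bip, which would re-prove `Bridge.safe_edgeCore_of_bipartite` for all `K` at once), non-empty for every
triangle-free graph tested at moderate `p`, but EMPTY for every non-bipartite graph at small enough `p` (the scaled core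
converges to the set of fractional 2-colourings, which is empty iff `χ_f > 2`; e.g. `C₅` at `p = 10⁻³`) — so the certificate is
a genuinely partial method, unlike the partition test itself (conjecture `TriangleFreeSafe`).
-/

noncomputable section

namespace Summit.CriticalPhenomena.PercolationContinuityZ3.Theorems.SunflowerPartition

namespace SafeCalc

open MeasureTheory Finset
open Literature.Probability.LatticeModels Literature.Probability.Percolation

variable {ι : Type*} [DecidableEq ι] (p : ι → unitInterval) (a : Finset ι)

/-! ## The fractional certificate -/

/-- One member lies in at most one of `n` pairwise disjoint classes, so the product over the classes AVOIDING it of a weight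
`t ∈ [0,1]` is at most `t^(n−1)`. [this work] -/
theorem prod_ite_notMem_le_pow {n : ℕ} (𝒰 : Fin n → Finset (Finset ι)) (hdisj : ∀ k l, k ≠ l → Disjoint (𝒰 k) (𝒰 l))
    (C : Finset ι) {t : ℝ} (ht0 : 0 ≤ t) (ht1 : t ≤ 1) :
    ∏ k, (if C ∉ 𝒰 k then t else 1) ≤ t ^ (n - 1) := by
  classical
  rw [← prod_filter, prod_const]
  set S : Finset (Fin n) := univ.filter fun k => C ∈ 𝒰 k with hS
  have hScard : S.card ≤ 1 := by
    refine Finset.card_le_one.2 fun k hk l hl => ?_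
    rw [hS, mem_filter] at hk hl
    by_contra hkl
    exact Finset.disjoint_left.1 (hdisj k l hkl) hk.2 hl.2
  have hc : (univ.filter fun k => C ∉ 𝒰 k).card = n - S.card := by
    have := Finset.card_filter_add_card_filter_not (s := (univ : Finset (Fin n))) (fun k => C ∈ 𝒰 k)
    rw [card_univ, Fintype.card_fin, ← hS] at this
    omega
  rw [hc]
  exact pow_le_pow_of_le_one ht0 ht1 (by omega)

/-- **Partition test from a fractional (balanced-weight) certificate.**  If weights `t C ∈ [0,1]` (`C ∈ 𝒯`) satisfy
`famIn p a 𝒯 𝒰 ≤ ∏_{C ∈ 𝒯 ∖ 𝒰} t C` for every sub-family `𝒰 ⊆ 𝒯` and `∏_{C ∈ 𝒯} t C ≤ famIn p a 𝒯 ∅`, then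
`∏_k famIn p a 𝒯 (𝒰 k) ≤ (famIn p a 𝒯 ∅)^(n−1)` for every `n` and all pairwise disjoint `𝒰 k ⊆ 𝒯`
(equivalently: the cost game `ℛ ↦ −log μ(ω meets every C ∈ ℛ)` has a non-empty core). [this work] -/
theorem disjoint_famIn_of_weights (𝒯 : Finset (Finset ι)) (t : Finset ι → ℝ) (ht0 : ∀ C ∈ 𝒯, 0 ≤ t C)
    (ht1 : ∀ C ∈ 𝒯, t C ≤ 1) (hprod : ∏ C ∈ 𝒯, t C ≤ famIn p a 𝒯 ∅)
    (hR : ∀ 𝒰, 𝒰 ⊆ 𝒯 → famIn p a 𝒯 𝒰 ≤ ∏ C ∈ 𝒯 \ 𝒰, t C) :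
    ∀ (n : ℕ) (𝒰 : Fin n → Finset (Finset ι)), (∀ k, 𝒰 k ⊆ 𝒯) → (∀ k l, k ≠ l → Disjoint (𝒰 k) (𝒰 l)) →
      ∏ k, famIn p a 𝒯 (𝒰 k) ≤ famIn p a 𝒯 ∅ ^ (n - 1) := by
  classical
  intro n 𝒰 hsub hdisj
  have hsd : ∀ k, ∏ C ∈ 𝒯 \ 𝒰 k, t C = ∏ C ∈ 𝒯, (if C ∉ 𝒰 k then t C else 1) := fun k => by
    rw [sdiff_eq_filter, prod_filter]
  calc ∏ k, famIn p a 𝒯 (𝒰 k) ≤ ∏ k, ∏ C ∈ 𝒯 \ 𝒰 k, t C :=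
        prod_le_prod (fun k _ => famIn_nonneg p a 𝒯 _) fun k _ => hR _ (hsub k)
    _ = ∏ k, ∏ C ∈ 𝒯, (if C ∉ 𝒰 k then t C else 1) := prod_congr rfl fun k _ => hsd k
    _ = ∏ C ∈ 𝒯, ∏ k, (if C ∉ 𝒰 k then t C else 1) := prod_comm
    _ ≤ ∏ C ∈ 𝒯, t C ^ (n - 1) := by
        refine prod_le_prod (fun C hC => prod_nonneg fun k _ => ?_) fun C hC =>
          prod_ite_notMem_le_pow 𝒰 hdisj C (ht0 C hC) (ht1 C hC)
        split_ifs
        · exact zero_le_one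
        · exact ht0 C hC
    _ = (∏ C ∈ 𝒯, t C) ^ (n - 1) := prod_pow 𝒯 (n - 1) t
    _ ≤ famIn p a 𝒯 ∅ ^ (n - 1) := pow_le_pow_left₀ (prod_nonneg fun C hC => ht0 C hC) hprod _

/-- The weights of a certificate multiply EXACTLY to `famIn ∅ = μ A` (the case `𝒰 = ∅` of the hypothesis gives the other
inequality). [this work] -/
theorem prod_weights_eq (𝒯 : Finset (Finset ι)) (t : Finset ι → ℝ) (hprod : ∏ C ∈ 𝒯, t C ≤ famIn p a 𝒯 ∅)
    (hR : ∀ 𝒰, 𝒰 ⊆ 𝒯 → famIn p a 𝒯 𝒰 ≤ ∏ C ∈ 𝒯 \ 𝒰, t C) : ∏ C ∈ 𝒯, t C = famIn p a 𝒯 ∅ := by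
  refine le_antisymm hprod ?_
  have h := hR ∅ (empty_subset _)
  rwa [sdiff_empty] at h

/-- **Safety from a fractional certificate.**  Under the hypotheses of `safe_of_disjoint_famIn` on `(A, a, 𝒯)`, a
balanced-weight certificate `t` for `famIn p a 𝒯` makes `A` safe at `p` — for every number of petals at once. [this work] -/
theorem safe_of_weights [Fintype ι] {A : Set (Set ι)} (hd : DeterminedBy A (↑a : Set ι)) (hu : IsUpperSet A)
    (𝒯 : Finset (Finset ι)) (h𝒯a : ∀ C ∈ 𝒯, C ⊆ a) (hbad : ∀ C ∈ 𝒯, ((a \ C : Finset ι) : Set ι) ∉ A)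
    (hcov : ∀ T, T ⊆ a → ((a \ T : Finset ι) : Set ι) ∉ A → ∃ C ∈ 𝒯, C ⊆ T)
    (t : Finset ι → ℝ) (ht0 : ∀ C ∈ 𝒯, 0 ≤ t C) (ht1 : ∀ C ∈ 𝒯, t C ≤ 1)
    (hprod : ∏ C ∈ 𝒯, t C ≤ famIn p a 𝒯 ∅) (hR : ∀ 𝒰, 𝒰 ⊆ 𝒯 → famIn p a 𝒯 𝒰 ≤ ∏ C ∈ 𝒯 \ 𝒰, t C) :
    Safe p A :=
  safe_of_disjoint_famIn p a hd hu 𝒯 h𝒯a hbad hcov (disjoint_famIn_of_weights p a 𝒯 t ht0 ht1 hprod hR)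

/-! ## The two-weight certificate of a disconnected core (the simplest non-trivial instance)

If `𝒯 = {C₁, C₂}` with `C₁ ∩ C₂ = ∅` then `famIn {C₂} = μ(ω meets C₁)`, `famIn {C₁} = μ(ω meets C₂)` and (independence of
disjoint blocks) `famIn ∅ = famIn {C₁} · famIn {C₂}`, so `t Cᵢ := μ(ω meets Cᵢ)` is a certificate.  We only record the
general two-member statement that is actually used by the partition test: for `#𝒯 ≤ 2` every tuple of pairwise disjoint
classes has at most two non-empty members and the test is Harris (`famIn_two_le`), so no certificate is needed there; the
certificate becomes informative from three members on (memo §2: it exists for every bipartite graph core tested). -/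

/-- For a core with at most two bad members the partition test holds outright (Harris), whatever the weights. [this work] -/
theorem disjoint_famIn_of_card_le_two [Fintype ι] (𝒯 : Finset (Finset ι)) (h𝒯a : ∀ C ∈ 𝒯, C ⊆ a) (h2 : 𝒯.card ≤ 2)
    (hh : 0 < famIn p a 𝒯 ∅) :
    ∀ (n : ℕ) (𝒰 : Fin n → Finset (Finset ι)), (∀ k, 𝒰 k ⊆ 𝒯) → (∀ k l, k ≠ l → Disjoint (𝒰 k) (𝒰 l)) →
      ∏ k, famIn p a 𝒯 (𝒰 k) ≤ famIn p a 𝒯 ∅ ^ (n - 1) := by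
  classical
  refine disjoint_famIn_of_nonempty p a 𝒯 hh fun k hk 𝒰 hsub hne hdisj => ?_
  have hk2 : k ≤ 2 := hk.trans h2
  have h1 : famIn p a 𝒯 ∅ ≤ 1 := famIn_le_one p a 𝒯 ∅
  interval_cases k
  · simp
  · rw [Fin.prod_univ_one]
    simpa using famIn_le_one p a 𝒯 (𝒰 0)
  · rw [Fin.prod_univ_two]
    simpa using famIn_two_le p a h𝒯a (hdisj 0 1 (by decide))

end SafeCalc

end Summit.CriticalPhenomena.PercolationContinuityZ3.Theorems.SunflowerPartition
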